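import Summits.ResolutionOfSingularities.ResolutionOfSingularities.Theorems.PPowerFormLucas
import HarnessLib

/-!
# PPowerForm — decomp-res node «FrobeniusForm» (lens-4 g23, critic row 144), tree file 3/4 of the node

Content VERBATIM from the decomp-res lens-4 g23 file `HOME/decomp-res-lens-4/g23/FrobeniusForm.lean` (sha256
24d32aa2…, 1018 l; HOME = run/shared/lean/pub/decomp-res).
Critic: CRITIC-LEDGER row 144 (CLEARED 2026-08-30T20:58:02Z; MAP node: the two-way census dictionary «initial form
a `p`-power form ⟺ absolutely contact-free»
as a KERNEL theorem).  Split by the lens's sections for the 400-line limit (the critic's `PPowerForm` = §55–§57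
is two files here).  Landed by decomp-res writer g7
in the lens's namespace `…Theorems.HugValuationCut`.  Asides: NONE new — 28338
`LCNoWildContactFreeOffLocusTowers` stays the booked residual; `NoWildPPowerOffLocusTowers`
lands as a def with its up-link, to supersede 28338 only when an every-field iff makes the re-location exact (critic).

§56 (l. 514–568) the RING-LEVEL dictionary and §57 (l. 570–743) the SCHEME-LEVEL dictionary: `PPowerFormAt`,
`isAbsContactAt_iff_not_pPowerFormAt` /
`_fg`, `FGGround`.  PROVED, 0 sorry (standard axioms).  Imports `PPowerFormLucas`.

[WRITER NOTE (decomp-res writer g7): file split only; namespace, section variables and every declaration exactly as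
in the lens (global `set_option` dropped).  The lens's
first import `MaxContactCutTameCut` (in the Theses cone, unused by any proof here) is replaced by the cone-free
`TameCutKernels` + `AbsoluteContactAxes` and the then-dangling
`open …Theses` dropped, so the whole node is OUTSIDE the Theses cone and importable by the route file when a later
every-field iff re-locates 28338.]

(Sources: Abad2019 Thm 4.11 / Prop 6.3; Giraud1975; CossartJannsenSaito2020; CossartPiltant2019 Prop. 2.50;
KawanoueMatsuki2016 §0.4.2; EGA IV₄ 16.11.2; Stacks 00TV.)
-/

noncomputable section

open CategoryTheory AlgebraicGeometry IsLocalRing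
open Literature.AlgebraicGeometry.Resolution
open Summit.ResolutionOfSingularities.ResolutionOfSingularities.Theorems
open WeakOrderReduction ForcedTowerClasses DivergentTowerClasses MonomialTowerClasses
open HugDimensionClasses HugDimensionKernels SurfaceShadowClasses SurfaceShadowKernels
open NearPointCut (SingularClass)
open AbsoluteContactClasses (IsAbsContactAt SepResidueAt diffIdeal_restrict_le stalkMap_comp_toStalk_eq_stalkHom)
open scoped BigOperators

namespace Summit.ResolutionOfSingularities.ResolutionOfSingularities.Theorems.HugValuationCut

/-! ## §56 (g23 · NEW · KERNEL) THE RING-LEVEL DICTIONARY for an ideal `J` of `𝔪`-adic order exactly `N + 1` in a local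
ring of characteristic `p` carrying a truncated Hasse–Schmidt system (over any field of scalars): `Diff^{≤N}_ℤ(J)` meets
`𝔪 ∖ 𝔪²` unless (`p ∣ N + 1` and `J ⊆ ⟨h^p : h ∈ 𝔪^{(N+1)/p}⟩ + 𝔪^{N+2}`), in which case
`Diff^{≤N}_ℤ(J) ⊆ 𝔪²`. -/

section RingDictionary

variable {k₀ : Type} [Field k₀] {S : Type} [CommRing S] [IsLocalRing S] [Algebra k₀ S]
variable {ι : Type*} [Fintype ι] [DecidableEq ι]

/-- in a ring of prime characteristic `p` the integers prime to `p` are units. [folklore] -/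
theorem isUnit_natCast_of_not_dvd {A : Type*} [CommRing A] {p : ℕ} [Fact p.Prime] [CharP A p] (m : ℕ) (hm : ¬ p ∣ m) :
    IsUnit ((m : ℕ) : A) := by
  have hz : ((m : ℕ) : ZMod p) ≠ 0 := fun h => hm ((ZMod.natCast_eq_zero_iff m p).mp h)
  have := (isUnit_iff_ne_zero.mpr hz).map (ZMod.castHom (dvd_refl p) A)
  rwa [map_natCast] at this

/-- **RING-LEVEL DICTIONARY, CONTACT SIDE (KERNEL, PROVED)**: given a truncated Hasse–Schmidt system of level `N + 1`
along generators of `𝔪` (scalars any field `k₀`), an ideal `J ⊆ 𝔪^{N+1}`, `J ⊄ 𝔪^{N+2}`, which is NOT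
a `p`-power form
(`¬ (p ∣ N+1 ∧ J ⊆ ⟨h^p : h ∈ 𝔪^{(N+1)/p}⟩ + 𝔪^{N+2})`) has an ABSOLUTE contact element:
`Diff^{≤N}_ℤ(J) ∩ (𝔪 ∖ 𝔪²) ≠ ∅`. (Sources: EGAIV4, Thm. 16.11.2; Giraud1975;
EncinasVillamayor2000, Thm. 4.9.) -/
theorem exists_mem_diffIdeal_of_not_pPower {p : ℕ} [hp : Fact p.Prime] [CharP S p]
    {u : ι → S} (hu : Ideal.span (Set.range u) = maximalIdeal S) {N : ℕ}
    {Δ : (ι →₀ ℕ) → (S →ₗ[k₀] S)} (h0 : ∀ b, Δ 0 b = b)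
    (hL : ∀ q : ι →₀ ℕ, q.degree ≤ N + 1 →
      ∀ f g : S, Δ q (f * g) = ∑ c ∈ Finset.HasAntidiagonal.antidiagonal q, Δ c.1 f * Δ c.2 g)
    (hV : ∀ q β : ι →₀ ℕ, q.degree ≤ N + 1 →
      Δ q (∏ i, u i ^ β i) = ((∏ i ∈ q.support, (β i).choose (q i) : ℕ) : S) * ∏ i, u i ^ (β - q) i)
    (hD : ∀ (d : ℕ) (q : ι →₀ ℕ), q.degree ≤ d → d ≤ N + 1 → IsDiffOpLE k₀ d (Δ q))
    {J : Ideal S} (hJ1 : J ≤ maximalIdeal S ^ (N + 1)) (hJ2 : ¬ J ≤ maximalIdeal S ^ (N + 2))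
    (hJ3 : ¬ (p ∣ N + 1 ∧
      J ≤ Ideal.span ((fun h : S => h ^ p) '' ↑(maximalIdeal S ^ ((N + 1) / p))) ⊔ maximalIdeal S ^ (N + 2))) :
    ∃ x ∈ diffIdeal ℤ N J, x ∈ maximalIdeal S ∧ x ∉ maximalIdeal S ^ 2 := by
  classical
  have hunit : ∀ m : ℕ, ¬ p ∣ m → IsUnit ((m : ℕ) : S) := fun m hm => isUnit_natCast_of_not_dvd m hm
  have conclude : ∀ {f : S}, f ∈ J → ∀ q : ι →₀ ℕ, q.degree = N → Δ q f ∈ maximalIdeal S →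
      Δ q f ∉ maximalIdeal S ^ 2 → ∃ x ∈ diffIdeal ℤ N J, x ∈ maximalIdeal S ∧ x ∉ maximalIdeal S ^ 2 :=
    fun {f} hf q hq h1 h2 =>
      ⟨Δ q f, diffIdeal_restrict_le N _ (apply_mem_diffIdeal k₀ (hD N q hq.le (Nat.le_succ N)) hf), h1, h2⟩
  by_cases hpN : p ∣ N + 1
  · obtain ⟨f, hfJ, hf2⟩ : ∃ f ∈ J, f ∉ Ideal.span ((fun h : S => h ^ p) '' ↑(maximalIdeal S ^ ((N + 1) / p))) ⊔
        maximalIdeal S ^ (N + 2) := by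
      by_contra hcon
      push Not at hcon
      exact hJ3 ⟨hpN, hcon⟩
    obtain ⟨q, hq, hm1, hm2⟩ :=
      exists_hasse_apply_of_not_mem_pPowerSpan hu h0 hL hV hD hp.out hunit (hJ1 hfJ) hf2
    exact conclude hfJ q hq hm1 hm2
  · obtain ⟨f, hfJ, hf2⟩ : ∃ f ∈ J, f ∉ maximalIdeal S ^ (N + 2) := by
      by_contra hcon
      push Not at hcon
      exact hJ2 hcon
    obtain ⟨q, hq, hm1, hm2⟩ := exists_hasse_apply_mem_and_notMem_sq hu h0 hL hV hD hunit hpN (hJ1 hfJ) hf2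
    exact conclude hfJ q hq hm1 hm2

end RingDictionary

/-! ## §57 (g23 · NEW · KERNEL, hypothesis-free, standard axioms) THE SCHEME-LEVEL DICTIONARY
`IsAbsContactAt 𝓘 n y ⟺ ¬ PPowerFormAt p 𝓘 n y` — over perfect fields at EVERY point, over finitely
generated fields at
EVERY point; the contact-free direction over ANY scheme. -/

section SchemeDictionary

/-- **`PPowerFormAt p 𝓘 n y` — THE INITIAL IDEAL IS A `p`-POWER FORM** (NEW OBJECT of this node, intrinsic): `p ∣ n` and
`𝓘_y ⊆ ⟨h^p : h ∈ 𝔪_y^{n/p}⟩ + 𝔪_y^{n+1}`, i.e. the degree-`n` initial forms of the elements of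
`𝓘_y` are `κ(y)`-linear
combinations of `p`-th powers of forms of degree `n/p`: in any regular system of parameters every unit-coefficient monomial
of every initial form has all exponents `≡ 0 (mod p)` (the census bit of HOME/census/it/T-wild-in, negated).
DEFINITION (support). -/
def PPowerFormAt (p : ℕ) {Y : Scheme.{0}} (I : Y.IdealSheafData) (n : ℕ) (y : Y) : Prop :=
  p ∣ n ∧ stalkIdeal I y ≤
    Ideal.span ((fun h : Y.presheaf.stalk y => h ^ p) '' ↑(maximalIdeal (Y.presheaf.stalk y) ^ (n / p))) ⊔
      maximalIdeal (Y.presheaf.stalk y) ^ (n + 1)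

/-- **KERNEL (PROVED, ⟸ of the dictionary, ANY scheme): a `p`-POWER FORM IS ABSOLUTELY CONTACT-FREE** — at a point whose
local ring has characteristic `p`, `PPowerFormAt p 𝓘 n y` (`n ≥ 1`) forces `Diff^{≤n−1}_ℤ(𝓘_y) ⊆
𝔪_y²`, so NO absolute
differential operator of order `< n` extracts a regular parameter: the Frobenius gain §54.  No base field, no
regularity, no Hasse system. (Sources: EGAIV4, Prop. 16.8.8; Giraud1975; CossartPiltant2008, Prop. 4.2.) -/
theorem not_isAbsContactAt_of_pPowerFormAt {p : ℕ} [hp : Fact p.Prime] {Y : Scheme.{0}} {I : Y.IdealSheafData} {n : ℕ}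
    {y : Y} [CharP (Y.presheaf.stalk y) p] (hn : 0 < n) (h : PPowerFormAt p I n y) : ¬ IsAbsContactAt I n y := by
  rintro ⟨x, hx, hx1, hx2⟩
  obtain ⟨⟨m, hm⟩, hle⟩ := h
  have hN : n - 1 < p * (n / p) := by
    rw [hm, Nat.mul_div_cancel_left _ hp.out.pos]; omega
  have := diffIdeal_le_sq_of_le_pPowerSpan (R := ℤ) p hN (maximalIdeal (Y.presheaf.stalk y))
    (J := stalkIdeal I y) (by rwa [show n - 1 + 2 = n + 1 by omega])
  exact hx2 (this hx)

variable {K : Type} [Field K]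

/-- the standard `K`-algebra structure of a stalk of a `K`-scheme makes it essentially of finite type when the structure
map is locally of finite type (support plumbing, as in g21/g22). (Sources: EGAIV4, Prop. 1.3.8 (EFT stalks).) -/
theorem essFiniteType_stalk {Y : Scheme.{0}} (g : Y ⟶ Spec (.of K)) [LocallyOfFiniteType g] (y : Y) :
    letI := stalkAlgebra (g.appTop.hom.comp (Scheme.ΓSpecIso (.of K)).inv.hom) y
    Algebra.EssFiniteType K (Y.presheaf.stalk y) := by
  let R := (Spec (CommRingCat.of K)).presheaf.stalk (g y)
  let S := Y.presheaf.stalk y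
  letI algRS : Algebra R S := (g.stalkMap y).hom.toAlgebra
  letI algKR : Algebra K R := StructureSheaf.stalkAlgebra (↑(CommRingCat.of K)) (g y)
  haveI : IsLocalization.AtPrime R (g y).asIdeal :=
    StructureSheaf.IsLocalization.to_stalk (↑(CommRingCat.of K)) (g y)
  haveI : Algebra.EssFiniteType K R := Algebra.EssFiniteType.of_isLocalization R (g y).asIdeal.primeCompl
  letI algKS : Algebra K S := stalkAlgebra (g.appTop.hom.comp (Scheme.ΓSpecIso (.of K)).inv.hom) y
  haveI : IsScalarTower K R S := IsScalarTower.of_algebraMap_eq' (stalkMap_comp_toStalk_eq_stalkHom g y).symm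
  haveI : Algebra.EssFiniteType R S := LocallyOfFiniteType.stalkMap g y
  exact Algebra.EssFiniteType.comp K R S

/-- order exactly `n ≥ 1` unpacked: `𝓘_y ⊆ 𝔪^n`, `𝓘_y ⊄ 𝔪^{n+1}`. [folklore] -/
theorem stalkIdeal_le_and_not_le_of_idealOrder {Y : Scheme.{0}} (I : Y.IdealSheafData) (y : Y) {N : ℕ}
    (hord : idealOrder I y = ((N + 1 : ℕ) : ℕ∞)) :
    stalkIdeal I y ≤ maximalIdeal (Y.presheaf.stalk y) ^ (N + 1) ∧
      ¬ stalkIdeal I y ≤ maximalIdeal (Y.presheaf.stalk y) ^ (N + 2) := by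
  refine ⟨(le_idealOrder_iff I y (N + 1)).mp hord.ge, fun h => ?_⟩
  have h1 := (le_idealOrder_iff I y (N + 2)).mpr h
  rw [hord] at h1
  exact absurd (ENat.coe_le_coe.mp h1) (by omega)

/-- **KERNEL (PROVED, ⟹ of the dictionary over a PERFECT field, EVERY point): a non-`p`-power form has ABSOLUTE CONTACT.**
On a base of the class over a perfect field `k` of characteristic `p`, at ANY point `y` (closed or not) an ideal of order
exactly `n` which is not a `p`-power form at `y` has an absolute contact element `u ∈ Diff^{≤n−1}_ℤ(𝓘_y)
∩ (𝔪_y ∖ 𝔪_y²)`: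
the stalk is regular and essentially of finite type over the perfect `k`, hence formally smooth (tree
`formallySmooth_of_isRegularLocalRing_of_perfectField`, Stacks 00TV), hence carries a `k`-linear Hasse system along a
regular system of parameters (tree `exists_hasseSystem_of_span_eq_maximalIdeal`, EGA IV₄ 16.11.2); then §56.
(Sources: EGAIV4, Thm. 16.11.2; StacksProject, Tag 00TV; Giraud1975; EncinasVillamayor2000, Thm. 4.9.) -/
theorem isAbsContactAt_of_not_pPowerFormAt {p : ℕ} (hp : p.Prime) [CharP K p] [PerfectField K] {Y : Scheme.{0}}
    (g : Y ⟶ Spec (.of K)) (hB : IsBase Y g) (I : Y.IdealSheafData) {n : ℕ} {y : Y} (hn : 0 < n)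
    (hord : idealOrder I y = ((n : ℕ) : ℕ∞)) (h : ¬ PPowerFormAt p I n y) : IsAbsContactAt I n y := by
  classical
  obtain ⟨N, rfl⟩ : ∃ N, n = N + 1 := ⟨n - 1, by omega⟩
  obtain ⟨hle, hnle⟩ := stalkIdeal_le_and_not_le_of_idealOrder I y hord
  haveI := Fact.mk hp
  haveI : LocallyOfFiniteType g := hB.locallyOfFiniteType
  let S := Y.presheaf.stalk y
  letI algKS : Algebra K S := stalkAlgebra (g.appTop.hom.comp (Scheme.ΓSpecIso (.of K)).inv.hom) y
  haveI : Algebra.EssFiniteType K S := essFiniteType_stalk g y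
  haveI : IsRegularLocalRing S := hB.isRegular y
  haveI : Algebra.FormallySmooth K S := formallySmooth_of_isRegularLocalRing_of_perfectField K S
  haveI : CharP S p := charP_of_injective_algebraMap (algebraMap K S).injective p
  obtain ⟨s, hcard, hspan⟩ :=
    Submodule.FG.exists_span_finset_card_eq_spanFinrank (IsNoetherian.noetherian (maximalIdeal S))
  have hu : Ideal.span (Set.range fun x : ↥s => (x : S)) = maximalIdeal S := by
    rw [Subtype.range_coe_subtype, Finset.setOf_mem]; exact hspan
  have hcard' : Fintype.card ↥s = (maximalIdeal S).spanFinrank := by rw [Fintype.card_coe]; exact hcard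
  obtain ⟨Δ, h0, hL, hV, hD⟩ :=
    exists_hasseSystem_of_span_eq_maximalIdeal (k := K) (fun x : ↥s => (x : S)) hu hcard' (N + 1)
  obtain ⟨x, hx, hx1, hx2⟩ := exists_mem_diffIdeal_of_not_pPower (p := p) hu h0 hL hV hD hle hnle h
  exact ⟨x, by rwa [Nat.add_sub_cancel], hx1, hx2⟩

/-- **THE TWO-WAY DICTIONARY over a PERFECT field (KERNEL, PROVED, hypothesis-free)**: on a base of the class over a perfect
field `k` of characteristic `p`, at EVERY point `y` of an ideal of order exactly `n ≥ 1`: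
ABSOLUTE CONTACT ⟺ THE INITIAL IDEAL IS NOT A `p`-POWER FORM.  In particular at an `𝔽_p`-point of a chart of the census
(coefficients in `𝔽_p` are their own `p`-th powers) the census bit «some exponent of the initial form ≢ 0 (mod p)» IS
`IsAbsContactAt`, both ways. (Sources: EGAIV4, Thm. 16.11.2, Prop. 16.8.8; Giraud1975; CossartPiltant2008, Prop. 4.2.) -/
theorem isAbsContactAt_iff_not_pPowerFormAt {p : ℕ} (hp : p.Prime) [CharP K p] [PerfectField K] {Y : Scheme.{0}}
    (g : Y ⟶ Spec (.of K)) (hB : IsBase Y g) (I : Y.IdealSheafData) {n : ℕ} {y : Y} (hn : 0 < n)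
    (hord : idealOrder I y = ((n : ℕ) : ℕ∞)) : IsAbsContactAt I n y ↔ ¬ PPowerFormAt p I n y := by
  refine ⟨fun hc hP => ?_, isAbsContactAt_of_not_pPowerFormAt hp g hB I hn hord⟩
  haveI := Fact.mk hp
  haveI : LocallyOfFiniteType g := hB.locallyOfFiniteType
  letI := stalkAlgebra (g.appTop.hom.comp (Scheme.ΓSpecIso (.of K)).inv.hom) y
  haveI : IsRegularLocalRing (Y.presheaf.stalk y) := hB.isRegular y
  haveI : CharP (Y.presheaf.stalk y) p := charP_of_injective_algebraMap (algebraMap K (Y.presheaf.stalk y)).injective p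
  exact not_isAbsContactAt_of_pPowerFormAt hn hP hc

/-- **COROLLARY (KERNEL, PROVED): TAME ABSOLUTE CONTACT AT EVERY POINT over a perfect field** — `p ∤ n` is never a
`p`-power form. (g21's `hsPortSepResidue` route needed `y` in the smooth locus with separable residue field; lens-6's
`isAbsContactAt_of_not_dvd` gives closed points over every field.) (Sources: EGAIV4, Thm. 16.11.2.) -/
theorem isAbsContactAt_of_tame_perfect {p : ℕ} (hp : p.Prime) [CharP K p] [PerfectField K] {Y : Scheme.{0}}
    (g : Y ⟶ Spec (.of K)) (hB : IsBase Y g) (I : Y.IdealSheafData) {n : ℕ} {y : Y}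
    (hord : idealOrder I y = ((n : ℕ) : ℕ∞)) (hpn : ¬ p ∣ n) : IsAbsContactAt I n y :=
  isAbsContactAt_of_not_pPowerFormAt hp g hB I (Nat.pos_of_ne_zero fun h => hpn (h ▸ dvd_zero p)) hord
    fun h => hpn h.1

/-- **`FGGround p K`** — the ground field `K` carries an `𝔽_p = ZMod p`-algebra structure ESSENTIALLY OF FINITE TYPE
(`K` a finitely generated field extension of `𝔽_p`: `𝔽_q`, `𝔽_p(t₁,…,t_m)` and its finite extensions
— perfect or not).
DEFINITION (support). -/
def FGGround (p : ℕ) (K : Type) [Field K] : Prop :=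
  ∃ _ : Algebra (ZMod p) K, Algebra.EssFiniteType (ZMod p) K

/-- **KERNEL (PROVED, ⟹ over a FINITELY GENERATED field, EVERY point)**: same conclusion over any `FGGround p K`
(perfect or not, separable residue or not): the stalk is essentially of finite type and formally smooth over the PERFECT
prime field `𝔽_p`, which carries the Hasse system. (Sources: EGAIV4, Thm. 16.11.2; StacksProject, Tag 00TV.) -/
theorem isAbsContactAt_of_not_pPowerFormAt_fg {p : ℕ} (hp : p.Prime) (hK : FGGround p K) {Y : Scheme.{0}}
    (g : Y ⟶ Spec (.of K)) (hB : IsBase Y g) (I : Y.IdealSheafData) {n : ℕ} {y : Y} (hn : 0 < n)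
    (hord : idealOrder I y = ((n : ℕ) : ℕ∞)) (h : ¬ PPowerFormAt p I n y) : IsAbsContactAt I n y := by
  classical
  obtain ⟨N, rfl⟩ : ∃ N, n = N + 1 := ⟨n - 1, by omega⟩
  obtain ⟨hle, hnle⟩ := stalkIdeal_le_and_not_le_of_idealOrder I y hord
  obtain ⟨algZK, hfgK⟩ := hK
  haveI := Fact.mk hp
  haveI : LocallyOfFiniteType g := hB.locallyOfFiniteType
  let S := Y.presheaf.stalk y
  letI algKS : Algebra K S := stalkAlgebra (g.appTop.hom.comp (Scheme.ΓSpecIso (.of K)).inv.hom) y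
  haveI : Algebra.EssFiniteType K S := essFiniteType_stalk g y
  letI algZS : Algebra (ZMod p) S := ((algebraMap K S).comp (algebraMap (ZMod p) K)).toAlgebra
  haveI : IsScalarTower (ZMod p) K S := IsScalarTower.of_algebraMap_eq fun _ => rfl
  haveI : Algebra.EssFiniteType (ZMod p) S := Algebra.EssFiniteType.comp (ZMod p) K S
  haveI : IsRegularLocalRing S := hB.isRegular y
  haveI : Algebra.FormallySmooth (ZMod p) S := formallySmooth_of_isRegularLocalRing_of_perfectField (ZMod p) S
  haveI : CharP S p := charP_of_injective_algebraMap (algebraMap (ZMod p) S).injective p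
  obtain ⟨s, hcard, hspan⟩ :=
    Submodule.FG.exists_span_finset_card_eq_spanFinrank (IsNoetherian.noetherian (maximalIdeal S))
  have hu : Ideal.span (Set.range fun x : ↥s => (x : S)) = maximalIdeal S := by
    rw [Subtype.range_coe_subtype, Finset.setOf_mem]; exact hspan
  have hcard' : Fintype.card ↥s = (maximalIdeal S).spanFinrank := by rw [Fintype.card_coe]; exact hcard
  obtain ⟨Δ, h0, hL, hV, hD⟩ :=
    exists_hasseSystem_of_span_eq_maximalIdeal (k := ZMod p) (fun x : ↥s => (x : S)) hu hcard' (N + 1)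
  obtain ⟨x, hx, hx1, hx2⟩ := exists_mem_diffIdeal_of_not_pPower (p := p) hu h0 hL hV hD hle hnle h
  exact ⟨x, by rwa [Nat.add_sub_cancel], hx1, hx2⟩

/-- **THE TWO-WAY DICTIONARY over a FINITELY GENERATED field (KERNEL, PROVED)**, at EVERY point.
(Sources: EGAIV4, Thm. 16.11.2, Prop. 16.8.8; Giraud1975.) -/
theorem isAbsContactAt_iff_not_pPowerFormAt_fg {p : ℕ} (hp : p.Prime) [CharP K p] (hK : FGGround p K)
    {Y : Scheme.{0}} (g : Y ⟶ Spec (.of K)) (hB : IsBase Y g) (I : Y.IdealSheafData) {n : ℕ} {y : Y} (hn : 0 < n)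
    (hord : idealOrder I y = ((n : ℕ) : ℕ∞)) : IsAbsContactAt I n y ↔ ¬ PPowerFormAt p I n y := by
  refine ⟨fun hc hP => ?_, isAbsContactAt_of_not_pPowerFormAt_fg hp hK g hB I hn hord⟩
  haveI := Fact.mk hp
  haveI : LocallyOfFiniteType g := hB.locallyOfFiniteType
  letI := stalkAlgebra (g.appTop.hom.comp (Scheme.ΓSpecIso (.of K)).inv.hom) y
  haveI : IsRegularLocalRing (Y.presheaf.stalk y) := hB.isRegular y
  haveI : CharP (Y.presheaf.stalk y) p := charP_of_injective_algebraMap (algebraMap K (Y.presheaf.stalk y)).injective p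
  exact not_isAbsContactAt_of_pPowerFormAt hn hP hc

/-- **COROLLARY (KERNEL, PROVED): TAME ABSOLUTE CONTACT AT EVERY POINT over a finitely generated field** (perfect or
not, separable residue or not). (Sources: EGAIV4, Thm. 16.11.2.) -/
theorem isAbsContactAt_of_tame_fg {p : ℕ} (hp : p.Prime) (hK : FGGround p K) {Y : Scheme.{0}}
    (g : Y ⟶ Spec (.of K)) (hB : IsBase Y g) (I : Y.IdealSheafData) {n : ℕ} {y : Y}
    (hord : idealOrder I y = ((n : ℕ) : ℕ∞)) (hpn : ¬ p ∣ n) : IsAbsContactAt I n y :=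
  isAbsContactAt_of_not_pPowerFormAt_fg hp hK g hB I (Nat.pos_of_ne_zero fun h => hpn (h ▸ dvd_zero p)) hord
    fun h => hpn h.1

end SchemeDictionary

end Summit.ResolutionOfSingularities.ResolutionOfSingularities.Theorems.HugValuationCut
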